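import Literature.AnabelianGeometry.SemiGraphs.PSCVertexQuotientProofs
import Literature.AnabelianGeometry.SemiGraphs.PSCGraphicitySub
import Literature.AnabelianGeometry.SemiGraphs.ProSigmaCompletionInjective
import Literature.AnabelianGeometry.SemiGraphs.PSCRamificationCyclicProofs
import Mathlib.Data.ZMod.QuotientGroup
import HarnessLib

/-!
# [CombGC] Theorem 1.6 sub-DAG, row T16-L13: "[nontrivial!]" — no vertex quotient is trivial

[IUTchI] Remark 1.2.3 (iv) (kurims p. 42): "Thus, since `G` is sturdy, the set of vertices of `G` may
be characterized as the set of [nontrivial!] quotients `M^unr-vert_G ↠ M^unr_G[v] ⊗ F_l`."  The word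
"nontrivial" is the point where sturdiness ("genus ≥ 2", [CombGC] Rmk. 1.1.5; "the abelianization of
every unramified verticial subgroup … free", Def. 1.1 (ii)) enters: `M^unr_G[v]` is free over `Ẑ^Σ`
of rank `2·genus(v) > 0`, so `M^unr_G[v] ⊗ F_l ≠ 0`.  Over abc-iut-L3-t4's interface and the
statements of `PSCGraphicitySub(2).lean` (abc-iut-w4-d052) this file PROVES the hypothesis `hK` of
`PSCVertexQuotientProofs.lean`:

* `unrVertAbOf_le_closure_pow_of_eq` — if `Ker_v = M^unr-vert_G` then `M^unr_G[v]` is generated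
  (topologically, modulo `E^unr_G`) by `l`-th powers (uses the independence clause of
  `UnrVerticialSplitInjection`);
* `vertexQuotientKer_ne_unrVertAb` — **"[nontrivial!]"**: for sturdy `G`, `Σ ∋ l` prime, granted the
  independence of the `M^unr_G[w]` (`UnrVerticialSplitInjection`) and the rank of `M^unr_G[v]`
  (`UnrVertAbOfRank`), `Ker_v ≠ M^unr-vert_G` — a pro-`Σ` completion of `ℤ^{2g}`, `2g ≥ 1`, has a proper
  open subgroup containing all `l`-th powers (the one cutting out `{γ : l ∣ γ₀}`);
* `vertexSetCharacterization_of_inputs` — hence `G.VertexSetCharacterization`.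

Proof-only (0 defs); plain profinite group theory; nothing here takes a side on [IUTchIII] Cor. 3.12.
[cite: Mochizuki2012, IUTchI Rmk 1.2.3(iv) p.42] [cite: MochizukiCombGC2007, Rmk 1.1.5 p.8]
-/

noncomputable section

namespace Literature.AnabelianGeometry.SemiGraphs

namespace PSCDatum

open scoped Pointwise
open SemiGraphOfAnabelioids (IsProSigmaCompletion)

universe u

variable {P : Type u} [Group P] [TopologicalSpace P] [IsTopologicalGroup P]

/-! ### The commutator subgroup lies in `E^unr_G` -/

/-- `⁅Π, Π⁆ ⊆ E^unr_G`. [cite: Mochizuki2012, IUTchI Rmk 1.2.3(i) p.41] -/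
theorem commutator_le_unrAbKer (G : PSCDatum P) : ⁅(⊤ : Subgroup P), ⊤⁆ ≤ G.unrAbKer :=
  le_sup_left.trans (Subgroup.le_topologicalClosure _)

/-! ### If `Ker_v` were everything, `M^unr_G[v]` would be generated by `l`-th powers -/

section Compact

variable [CompactSpace P] [T2Space P]

/-- The independence clause of `UnrVerticialSplitInjection` turns `Ker_v = M^unr-vert_G` into:
`M^unr_G[v]` (preimage) is the closed subgroup generated by `E^unr_G` and the `l`-th powers of its
elements. [cite: Mochizuki2012, IUTchI Rmk 1.2.3(iv) p.42] -/
theorem unrVertAbOf_le_closure_pow_of_eq (G : PSCDatum P) {l : ℕ} {v : G.graph.V}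
    (hind : G.unrVertAbOf v ⊓
        (⨆ w : {w : G.graph.V // w ≠ v}, G.unrVertAbOf w.1).topologicalClosure = G.unrAbKer)
    (hEq : G.vertexQuotientKer l v = G.unrVertAb) :
    G.unrVertAbOf v ≤
      (G.unrAbKer ⊔ Subgroup.closure ((fun g : P => g ^ l) '' (G.unrVertAbOf v : Set P))
        ).topologicalClosure := by
  set A := G.unrVertAbOf v with hA
  set Lt := (G.unrAbKer ⊔ Subgroup.closure ((fun g : P => g ^ l) '' (A : Set P))).topologicalClosure
    with hLt
  set Bt := (⨆ w : {w : G.graph.V // w ≠ v}, G.unrVertAbOf w.1).topologicalClosure with hBt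
  -- `Lt ⊆ A`, `Lt` normal, `A ⊆ Ker_v ⊆ Lt ⊔ Bt`
  have hAc : IsClosed (A : Set P) := Subgroup.isClosed_topologicalClosure _
  have hLtA : Lt ≤ A := by
    refine Subgroup.topologicalClosure_minimal _ (sup_le (G.unrAbKer_le_unrVertAbOf v)
      ((Subgroup.closure_le _).mpr ?_)) hAc
    rintro _ ⟨g, hg, rfl⟩
    exact pow_mem hg l
  haveI hLtn : Lt.Normal := normal_of_commutator_le
    ((G.commutator_le_unrAbKer.trans le_sup_left).trans (Subgroup.le_topologicalClosure _))
  have hKle : G.vertexQuotientKer l v ≤ Lt ⊔ Bt := by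
    have hclosed : IsClosed (((Lt ⊔ Bt : Subgroup P)) : Set P) := by
      rw [Subgroup.normal_mul, ← Set.image_mul_prod]
      exact (((Subgroup.isClosed_topologicalClosure _).isCompact.prod
        (Subgroup.isClosed_topologicalClosure _).isCompact).image continuous_mul).isClosed
    unfold vertexQuotientKer
    refine Subgroup.topologicalClosure_minimal _ (sup_le (sup_le ?_ ?_) ?_) hclosed
    · exact (le_sup_left.trans (Subgroup.le_topologicalClosure _)).trans le_sup_left
    · exact (Subgroup.le_topologicalClosure _).trans le_sup_right
    · exact (le_sup_right.trans (Subgroup.le_topologicalClosure _)).trans le_sup_left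
  have hAK : A ≤ G.vertexQuotientKer l v := hEq ▸ G.unrVertAbOf_le_unrVertAb v
  intro a ha
  have ha' : a ∈ ((Lt ⊔ Bt : Subgroup P) : Set P) := hKle (hAK ha)
  rw [Subgroup.normal_mul] at ha'
  obtain ⟨x, hx, b, hb, rfl⟩ := ha'
  have hbA : b ∈ A := by
    have := mul_mem (inv_mem (hLtA hx)) ha
    rwa [inv_mul_cancel_left] at this
  have hbE : b ∈ G.unrAbKer := by
    rw [← hind]
    exact ⟨hbA, hb⟩
  exact mul_mem hx ((le_sup_left.trans (Subgroup.le_topologicalClosure _) : G.unrAbKer ≤ Lt) hbE)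

end Compact

/-! ### A pro-`Σ` completion of `ℤ^r`, `r ≥ 1`, has a proper open subgroup containing the `l`-th powers -/

/-- In a pro-`Σ` completion `Q` of `ℤ^r` (`r ≥ 1`, `l ∈ Σ` prime) the `l`-th powers do not generate a
dense subgroup: the subgroup `{γ : l ∣ γ_{i₀}}` of index `l` is cut out by an open `U ⊊ Q`, and `U`
contains every `l`-th power. [cite: MochizukiCombGC2007, Rmk 1.1.5 p.8] -/
theorem exists_open_ne_top_pow_mem {Sigma : Set ℕ} {Q : Type*} [Group Q] [TopologicalSpace Q]
    [IsTopologicalGroup Q] {r : ℕ} (i₀ : Fin r) {ι : Multiplicative (Fin r → ℤ) →* Q}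
    (hι : IsProSigmaCompletion Sigma ι) {l : ℕ} (hl : l.Prime) (hlS : l ∈ Sigma) :
    ∃ U : Subgroup Q, IsOpen (U : Set Q) ∧ U ≠ ⊤ ∧ ∀ x : Q, x ^ l ∈ U := by
  -- the index-`l` subgroup `{γ : l ∣ γ i₀}`
  let Na : AddSubgroup (Fin r → ℤ) :=
    (AddSubgroup.zmultiples (l : ℤ)).comap (Pi.evalAddMonoidHom (fun _ : Fin r => ℤ) i₀)
  let N : Subgroup (Multiplicative (Fin r → ℤ)) := AddSubgroup.toSubgroup Na
  have hmemN : ∀ γ : Multiplicative (Fin r → ℤ), γ ∈ N ↔ (l : ℤ) ∣ Multiplicative.toAdd γ i₀ := by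
    intro γ
    rw [Multiplicative.mem_toSubgroup, AddSubgroup.mem_comap, Int.mem_zmultiples_iff]
    rfl
  have hNidx : N.index = l := by
    rw [AddSubgroup.index_toSubgroup,
      AddSubgroup.index_comap_of_surjective _ (Function.surjective_eval i₀),
      AddSubgroup.index_eq_card, Nat.card_congr (Int.quotientZMultiplesNatEquivZMod l).toEquiv,
      Nat.card_zmod]
  haveI : N.Normal := inferInstance
  obtain ⟨U, hUo, hUN⟩ := hι.comap_surj N inferInstance (by
    rw [hNidx]
    simpa using SemiGraphOfAnabelioids.IsProSigmaCompletion.isSigmaInteger_prime_pow hl hlS 1)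
  refine ⟨U, hUo, fun hUtop => ?_, fun x => ?_⟩
  · -- `U = ⊤` would put `δ_{i₀}` in `N`, i.e. `l ∣ 1`
    have hδ : Multiplicative.ofAdd (Pi.single i₀ (1 : ℤ)) ∈ N := by
      rw [← hUN, hUtop]; exact Subgroup.mem_top _
    rw [hmemN] at hδ
    simp only [toAdd_ofAdd, Pi.single_eq_same] at hδ
    exact hl.one_lt.ne' (by exact_mod_cast Int.eq_one_of_dvd_one (by positivity) hδ)
  · -- every `l`-th power lies in the closed subgroup `U`, by density of `ι`
    have hUc : IsClosed (U : Set Q) := Subgroup.isClosed_of_isOpen U hUo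
    have hd : DenseRange ι := hι.dense
    refine hd.induction_on (p := fun x : Q => x ^ l ∈ U) x (hUc.preimage (continuous_pow l)) ?_
    intro γ
    rw [← map_pow]
    have : γ ^ l ∈ U.comap ι := by
      rw [hUN, hmemN]
      simp only [toAdd_pow, Pi.smul_apply]
      exact Dvd.intro _ rfl
    exact this

/-! ### "[nontrivial!]" -/

section Compact

variable [CompactSpace P] [T2Space P]

/-- **[IUTchI] Rmk. 1.2.3 (iv), "[nontrivial!]"**: for sturdy `G` of pro-`Σ` PSC-type with `l ∈ Σ`
prime, granted the independence of the `M^unr_G[w]` (`UnrVerticialSplitInjection`) and the rank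
`2·genus(v)` of `M^unr_G[v]` (`UnrVertAbOfRank`), the vertex quotient
`M^unr-vert_G ↠ M^unr_G[v] ⊗ F_l` is nontrivial: `Ker_v ≠ M^unr-vert_G`.
[cite: Mochizuki2012, IUTchI Rmk 1.2.3(iv) p.42] -/
theorem vertexQuotientKer_ne_unrVertAb (G : PSCDatum P) (hsplit : G.UnrVerticialSplitInjection)
    (hrank : G.UnrVertAbOfRank) (hGs : G.IsSturdy) {l : ℕ} (hlS : l ∈ G.Sigma) (v : G.graph.V) :
    G.vertexQuotientKer l v ≠ G.unrVertAb := by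
  intro hEq
  have hl : l.Prime := G.sigma_prime l hlS
  set A := G.unrVertAbOf v with hA
  set E := G.unrAbKer with hE
  haveI : E.Normal := normal_of_commutator_le G.commutator_le_unrAbKer
  haveI hEn : (E.subgroupOf A).Normal := inferInstance
  obtain ⟨ι, hι⟩ := hrank v
  have hr : 0 < 2 * G.genus v := by have := hGs v; omega
  obtain ⟨U, hUo, hUne, hUpow⟩ := exists_open_ne_top_pow_mem ⟨0, hr⟩ hι hl hlS
  apply hUne
  -- pull `U` back to `A ⊆ Π` and push into `Π`
  set π : A →* A ⧸ E.subgroupOf A := QuotientGroup.mk' (E.subgroupOf A) with hπ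
  set U' : Subgroup A := U.comap π with hU'
  have hU'c : IsClosed (U' : Set A) :=
    Subgroup.isClosed_of_isOpen _ (hUo.preimage (by exact QuotientGroup.continuous_mk))
  have hAc : IsClosed (A : Set P) := Subgroup.isClosed_topologicalClosure _
  set W : Subgroup P := U'.map A.subtype with hW
  have hWc : IsClosed (W : Set P) := by
    rw [hW, Subgroup.coe_map]
    exact hAc.isClosedEmbedding_subtypeVal.isClosedMap _ hU'c
  -- `E ⊔ ⟨l-th powers of A⟩ ⊆ W`
  have hEW : E ≤ W := by
    intro e he
    refine ⟨⟨e, G.unrAbKer_le_unrVertAbOf v he⟩, ?_, rfl⟩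
    change π ⟨e, _⟩ ∈ U
    have : π ⟨e, G.unrAbKer_le_unrVertAbOf v he⟩ = 1 :=
      (QuotientGroup.eq_one_iff _).mpr (by rw [Subgroup.mem_subgroupOf]; exact he)
    rw [this]; exact one_mem U
  have hLW : Subgroup.closure ((fun g : P => g ^ l) '' (A : Set P)) ≤ W := by
    refine (Subgroup.closure_le _).mpr ?_
    rintro _ ⟨a, ha, rfl⟩
    refine ⟨⟨a, ha⟩ ^ l, ?_, rfl⟩
    change π (⟨a, ha⟩ ^ l) ∈ U
    rw [map_pow]
    exact hUpow _
  have hAL := G.unrVertAbOf_le_closure_pow_of_eq ((hsplit hGs).1 v) hEq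
  have hAW : A ≤ W := hAL.trans (Subgroup.topologicalClosure_minimal _ (sup_le hEW hLW) hWc)
  -- hence `U' = ⊤` and `U = ⊤`
  rw [eq_top_iff]
  rintro x -
  obtain ⟨a, rfl⟩ := QuotientGroup.mk'_surjective (E.subgroupOf A) x
  obtain ⟨u, hu, hua⟩ := hAW a.2
  have : u = a := Subtype.ext hua
  subst this
  exact hu

/-- **`G.VertexSetCharacterization` from its inputs** (row T16-L13 of the cell's sub-DAG for [CombGC]
Thm. 1.6): independence of the `M^unr_G[w]` and the rank of `M^unr_G[v]` give "[nontrivial!]", hence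
(by `vertexSetCharacterization_of_ne`) the injectivity of `v ↦ Ker_v`.
[cite: Mochizuki2012, IUTchI Rmk 1.2.3(iv) p.42] -/
theorem vertexSetCharacterization_of_inputs (G : PSCDatum P)
    (hsplit : G.UnrVerticialSplitInjection) (hrank : G.UnrVertAbOfRank) :
    G.VertexSetCharacterization := by
  intro hGs l hS
  have hlS : l ∈ G.Sigma := by rw [hS]; exact Set.mem_singleton l
  exact ⟨G.vertexQuotientKer_injective_of_ne l
      (fun v => G.vertexQuotientKer_ne_unrVertAb hsplit hrank hGs hlS v),
    fun v => G.vertexQuotientKer_ne_unrVertAb hsplit hrank hGs hlS v⟩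

end Compact

end PSCDatum

end Literature.AnabelianGeometry.SemiGraphs

end
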